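import Summits.AnomalousDissipation.AnomalousDissipation.Theses.NeutralTaylorWaves

/-!
# Crux `NewtonRealisation` (stmt-AnomalousDissipation-16315, route NeutralTaylorWaves, rank 4) — birth skeleton

`Lines/birth.lean` (BC3): three NAMED stubs and the kernel-checked composition
`NewtonRealisation_of : stub₁ → stub₂ → stub₃ → NewtonRealisation` concluding the route decl
`Summit.AnomalousDissipation.AnomalousDissipation.Theses.NeutralTaylorWaves.NewtonRealisation` BY NAME
(hypotheses = the name-keyed aliases `__Registered.stub_*`, textually the stub signatures; sorries only
inside the three `stub_*`; wiring `example` at the end).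

## The crux

`NewtonRealisation : NonresonantTaylorWaves → (steady zeroth-law family)`: from ONE smooth steady
divergence-free mean-zero force `f`, viscosities `ν_n → 0⁺`, constants `E, ε₀ > 0, C₀, K₀` and — for every
order `K` — a constant `C_K` and infinitely many `n` carrying a smooth divergence-free mean-zero
quasi-steady state `(w, q, c)` (drift `c` along `x₃`, `|c| ≤ C_K`) that is LIGHT (`∫‖w‖² ≤ E`), LOUD
(`|ν_n‖∇w‖² − ε₀| ≤ C_K√ν_n`), quasi-steady to order `K` (`‖w·∇w − ν_nΔw + ∇q − c∂₃w − f‖²₂ ≤ C_K ν_n^K`),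
with sup bounds `|w| ≤ C_K`, `|∂w| ≤ C_Kν_n⁻¹`, `|∂∂w| ≤ C_Kν_n⁻²` and the bordered `L²` a-priori bound
`‖v‖²₂ + b² ≤ (C₀ν_n^{-K₀})²(‖w·∇v + v·∇w − ν_nΔv + ∇r − c∂₃v − b∂₃w‖²₂ + ⟨v, ∂₃w⟩²)` (all smooth
mean-zero divergence-free `v`, smooth `r`, real `b`), produce the body of `SteadyZerothLaw` (stmt-0219):
ONE force, `ν_j → 0⁺`, time-constant classical Navier–Stokes solutions `u_j` on `T³ × ℝ` with
`sup_j ∫‖u_j‖² < ∞` and `ν_j‖∇u_j‖²₂ ≥ ε₁ > 0`.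

## The cut: LINEAR THEORY ∣ NONLINEAR STEP ∣ DRIFT ABSORPTION (+ selection in the composition)

The Newton–Kantorovich proof named in the route header has exactly three analytic pieces, each at
FIXED viscosity, and a selection/bookkeeping layer along the nonresonant subsequence:

* `stub_borderedSolvability` (linear theory; size L): the bordered linearised steady operator at a
  smooth `(w, c)` obeying the crux's `L²` a-priori bound is SOLVABLE on smooth mean-zero data `(g, s)`
  with an `H²`-type estimate whose constant is POLYNOMIAL in `(C₀ν^{-K₀}, C, ν⁻¹)` with universal
  exponents: Fredholm index `0` (compact perturbation of `−νPΔ − c∂₃`, bordered by finite rank) +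
  injectivity from the a-priori bound + elliptic bookkeeping `ν‖Δv‖ ≤ ‖g‖ + (|w|_∞ + |c|)‖∇v‖ +
  3|∇w|_∞‖v‖ + |b||∇w|₂` with `‖∇v‖² ≤ ‖v‖‖Δv‖`.
* `stub_newtonStep` (the nonlinear heart; size L): for `K` large against `(k, K₀)` and `ν ≤ ν₀(K, C, …)`,
  an order-`K` quasi-steady state with the a-priori bound and the polynomial `H²`-solvability of its
  bordered linearisation has an EXACT smooth drifting steady state `(W, Q, c')` of the same force nearby:
  `|c' − c| ≤ 1`, `∫‖W‖² ≤ 2∫‖w‖² + 1`, `|ν‖∇W‖² − ν‖∇w‖²| ≤ √ν` (simplified Newton = Magnus Prop. 6.7, in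
  tree as `Literature.Analysis.Calculus.exists_zero_near_of_simplifiedNewton`, on the range of the right
  inverse; quadratic remainder `‖P(v·∇v)‖₂ ≲ ‖v‖²_{H²}` by `H²(T³) ⊂ L^∞`; residual `√(C ν^K)` beats the
  squared inverse bound `ν^{-2k(K₀+1)}`; regularity bootstrap back to `C^∞`).
* `stub_driftAbsorption` (Galilean bookkeeping on the torus; size M): a smooth drifting steady state
  `W·∇W − νΔW + ∇Q − c'∂₃W = f` gives the time-constant CLASSICAL solution `u = W − c'e₃` of `NS_ν(f)` on
  `T³ × ℝ` (`(W − c'e₃)·∇(W − c'e₃) = W·∇W − c'∂₃W`, `∂ₜu = 0`), with `‖∇u‖₂² = ‖∇W‖₂²` and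
  `∫‖u‖² = ∫‖W‖² + c'²` (mean-zero `W`, probability volume).

Composition (`NewtonRealisation_of`, no sorry): take `(k, A)` from stub 1, `K` from stub 2 at
`(k, A, C₀, K₀)`, `C = C_K` from the crux hypothesis, `ν₀` from stub 2; by `ν_n → 0` pick `N₁` with
`ν_n < δ := min ν₀ (ε₀/(2(|C|+2)))²` beyond `N₁`; for each `j` the crux hypothesis at `N := max N₁ j` gives
`n_j ≥ j` and a certified quasi-steady state; stub 1 feeds stub 2, stub 3 turns the exact drifting state
into `u_j`; energy `≤ 2E + 1 + (|C|+1)²`, dissipation `ν‖∇u_j‖² ≥ ε₀ − (C+1)√ν ≥ ε₀/2`; `ν ∘ n → 0` since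
`n_j ≥ j`.

Disproof used: none relevant — `ledger crux ls stmt-AnomalousDissipation-16315`: no workfiles (no
`Disproof.lean`, no `Theorems/NewtonRealisation/Negative/*`) at registration (2026-08-17). Negatives index
(6 refuted statements of the summit) honoured: none is a fixed-viscosity perturbation / Galilean
statement; the two Galilean-drift refutations (GPEnergyCeiling stmt-2979, EnergyUnboundedNeg stmt-0204)
kill UNIVERSAL-over-data energy ceilings, whereas here the drift `c'e₃` is subtracted from ONE constructed
state and its energy `c'²` is booked explicitly.

Hardest stub: `stub_newtonStep` (function-space set-up `H²_σ × ℝ → L²_σ × ℝ` on `T³`, right inverse from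
smooth solvability + the a-priori bound, Kantorovich smallness with explicit powers of `ν`, regularity).
-/

-- `Summit.<Summit>.<Problem>`: single-conjunct summit, the duplicate component is the tree's convention.
set_option linter.dupNamespace false

noncomputable section

open Filter Set MeasureTheory Topology
open Literature.Analysis.FunctionSpaces Literature.Analysis.FunctionSpaces.Torus

namespace Summit.AnomalousDissipation.AnomalousDissipation.Cruxes.NewtonRealisation.Birth

/-- The flat unit three-torus (local notation). -/
local notation "𝕋³" => UnitAddTorus (Fin 3)
/-- Velocity values (local notation). -/
local notation "E³" => EuclideanSpace ℝ (Fin 3)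

/-- **stub 1 — BORDERED LINEAR SOLVABILITY WITH POLYNOMIAL `H²` LOSS (linear theory; size L).**
There are universal `k : ℕ`, `A : ℝ` such that for every viscosity `ν > 0`, constants `C, C₀, K₀`, smooth
divergence-free mean-zero `w` and drift `c` with `|c| ≤ C`, `|w| ≤ C`, `|∂ᵢw| ≤ Cν⁻¹`, `|∂ᵢ∂ⱼw| ≤ Cν⁻²`
and the crux's bordered `L²` a-priori bound (constant `C₀ν^{-K₀}`), the bordered linearised steady system
`w·∇v + v·∇w − νΔv + ∇r − c∂₃v − b∂₃w = g`, `∫⟪v, ∂₃w⟫ = s` is solvable, for every smooth mean-zero `g`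
and real `s`, by smooth divergence-free mean-zero `v`, smooth `r`, real `b` with
`∫‖v‖² + ‖∇v‖₂² + Σᵢ‖∇∂ᵢv‖₂² + b² ≤ (A(1 + |C₀|ν^{-K₀})^k(1 + |C|)^k(1 + ν⁻¹)^k)²(∫‖g‖² + s²)`.
Why true: after Leray projection the bordered operator `(v, b) ↦ (P[w·∇v + v·∇w − νΔv − c∂₃v − b∂₃w], ⟨v,∂₃w⟩)`
on `H²_{σ,0} × ℝ → L²_{σ,0} × ℝ` is a compact-plus-finite-rank perturbation of the invertible
`(−νΔ − c∂₃) ⊕ id` (Fourier symbol `4π²ν|k|² − 2πick₃ ≠ 0`), hence Fredholm of index `0`; the a-priori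
bound (extended to `H²` by density) makes it injective, so bijective; the pressure `r` is the Hodge
potential of the gradient part; the `H²` constant follows from the `L²` bound and
`ν‖Δv‖ ≤ ‖g‖ + (C + |c|)‖∇v‖ + 3Cν⁻¹‖v‖ + √3 Cν⁻¹|b|`, `‖∇v‖² ≤ ‖v‖‖Δv‖`, `Σᵢⱼ‖∂ᵢ∂ⱼv‖² = ‖Δv‖²` on `T³`
— linear in `C₀ν^{-K₀}`, quadratic in `(C, ν⁻¹)`. Why it might fail: only through the function-space
set-up (density of smooth solenoidal fields in `H²_{σ,0}`, closed range) — the estimate itself is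
bookkeeping; a non-polynomial loss is excluded by the explicit elliptic inequality. Sources: Galdi2011
(steady linearised theory, Ch. IV–V, VIII), Temam1979 Ch. I §2 (Stokes/Leray on the torus),
doi:10.1137/0153002 (why only a polynomial RESOLVENT bound can be hoped for). Leans on:
`Torus.leray*`/`TorusLerayHelmholtz`, `TorusInverseLaplacian*`, `TorusSobolevNorm`, Mathlib Fredholm-free
route via `LinearMap` + compact embedding `TorusRellich` if present (else Riesz–Schauder by hand). -/
theorem stub_borderedSolvability :
    ∃ (k : ℕ) (A : ℝ), ∀ (ν C C₀ : ℝ) (K₀ : ℕ) (w : 𝕋³ → E³) (c : ℝ), 0 < ν →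
      IsSmooth w → IsDivFree w → HasZeroMean w → |c| ≤ C → (∀ x, ‖w x‖ ≤ C) →
      (∀ (i : Fin 3) x, ‖Torus.partialDeriv i w x‖ ≤ C * ν⁻¹) →
      (∀ (i j : Fin 3) x, ‖Torus.partialDeriv i (Torus.partialDeriv j w) x‖ ≤ C * ν⁻¹ ^ 2) →
      (∀ (v : 𝕋³ → E³) (r : 𝕋³ → ℝ) (b : ℝ), IsSmooth v → IsSmooth r → IsDivFree v → HasZeroMean v →
        MeasureTheory.integral MeasureTheory.volume (fun x => ‖v x‖ ^ 2) + b ^ 2 ≤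
          (C₀ * ν⁻¹ ^ K₀) ^ 2 * (MeasureTheory.integral MeasureTheory.volume (fun x =>
            ‖Torus.convect w v x + Torus.convect v w x - ν • Torus.laplacian v x + Torus.gradient r x -
              c • Torus.partialDeriv (2 : Fin 3) v x - b • Torus.partialDeriv (2 : Fin 3) w x‖ ^ 2) +
            (MeasureTheory.integral MeasureTheory.volume (fun x =>
              inner ℝ (v x) (Torus.partialDeriv (2 : Fin 3) w x))) ^ 2)) →
      ∀ (g : 𝕋³ → E³) (s : ℝ), IsSmooth g → HasZeroMean g →
        ∃ (v : 𝕋³ → E³) (r : 𝕋³ → ℝ) (b : ℝ), IsSmooth v ∧ IsSmooth r ∧ IsDivFree v ∧ HasZeroMean v ∧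
          (∀ x, Torus.convect w v x + Torus.convect v w x - ν • Torus.laplacian v x + Torus.gradient r x -
              c • Torus.partialDeriv (2 : Fin 3) v x - b • Torus.partialDeriv (2 : Fin 3) w x = g x) ∧
          MeasureTheory.integral MeasureTheory.volume (fun x =>
              inner ℝ (v x) (Torus.partialDeriv (2 : Fin 3) w x)) = s ∧
          MeasureTheory.integral MeasureTheory.volume (fun x => ‖v x‖ ^ 2) + gradNormSq v +
              (∑ i : Fin 3, gradNormSq (Torus.partialDeriv i v)) + b ^ 2 ≤
            (A * (1 + |C₀| * ν⁻¹ ^ K₀) ^ k * (1 + |C|) ^ k * (1 + ν⁻¹) ^ k) ^ 2 *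
              (MeasureTheory.integral MeasureTheory.volume (fun x => ‖g x‖ ^ 2) + s ^ 2) := by
  sorry

/-- **stub 2 — THE NEWTON–KANTOROVICH STEP AT FIXED VISCOSITY (the nonlinear heart; size L).**
For all `k, A, C₀, K₀` there is an order `K` such that for every `C` there is `ν₀ > 0` with: whenever
`0 < ν ≤ ν₀`, `f` is smooth divergence-free mean-zero, `(w, q, c)` is a smooth divergence-free mean-zero
quasi-steady state with `|c| ≤ C`, sup bounds `|w| ≤ C`, `|∂w| ≤ Cν⁻¹`, `|∂∂w| ≤ Cν⁻²`, residual
`‖w·∇w − νΔw + ∇q − c∂₃w − f‖²₂ ≤ Cν^K`, the bordered `L²` a-priori bound with constant `C₀ν^{-K₀}`, AND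
the bordered linearisation at `(w, c)` is solvable on smooth mean-zero data with `H²` constant
`A(1 + |C₀|ν^{-K₀})^k(1 + |C|)^k(1 + ν⁻¹)^k` (the conclusion of stub 1, verbatim), THEN there is an exact
smooth divergence-free mean-zero DRIFTING STEADY STATE `(W, Q, c')` of the same force,
`W·∇W − νΔW + ∇Q − c'∂₃W = f`, with `|c' − c| ≤ 1`, `∫‖W‖² ≤ 2∫‖w‖² + 1`, `|ν‖∇W‖² − ν‖∇w‖²| ≤ √ν`.
Why true: on `Z = H²_{σ,0}(T³) × ℝ` let `Φ(v, b) = (P[(w+v)·∇(w+v) − νΔ(w+v) − (c+b)∂₃(w+v) − f], ⟨v, ∂₃w⟩)`;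
`Φ(0) = (P·residual, 0)` has norm `≤ √(Cν^K)`; `DΦ(0)` is the bordered operator; the a-priori bound makes
smooth solutions unique, so the solution map of the hypothesis is LINEAR with norm `≤ M₂ =
A(1+|C₀|ν^{-K₀})^k(1+|C|)^k(1+ν⁻¹)^k ≤ A'ν^{-k(K₀+2)}` (`ν ≤ 1`) and extends to a bounded right inverse
`R` with closed range `X₁`; `DΦ(z) − DΦ(0)` is `(h, β) ↦ P[v·∇h + h·∇v − b∂₃h − β∂₃v]`, Lipschitz in `z`
with a UNIVERSAL constant `2c_S` (`H²(T³) ⊂ L^∞`); simplified Newton on `X₁`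
(`exists_zero_near_of_simplifiedNewton`, Magnus 2022 Prop. 6.7: `4·2c_S·M₂·M₂‖Φ(0)‖ ≤ 1`) needs
`8c_S M₂² √(Cν^K) ≤ 1`, true for `ν ≤ ν₀` once `K > 4k(K₀+2)`; the zero `(v⋆, b⋆)` has
`‖(v⋆, b⋆)‖_Z ≤ 2M₂√(Cν^K) ≤ ν²`, solves the steady system strongly, bootstraps to `C^∞` (smooth `w, f`;
`H²·H¹ ⊂ H¹` in 3-D), and `(I − P)[…] = −∇Q` (Hodge); `W := w + v⋆`, `c' := c + b⋆`; the three closeness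
clauses from `‖v⋆‖_{H²} ≤ ν²`, `‖∇w‖₂ ≤ √3·Cν⁻¹`. Why it might fail: the honest risks are the ones the
route names — the `H²`-loss must stay polynomial so that a finite `K` wins (guaranteed here by stub 1's
form), and the index/uniqueness bookkeeping with drift and border; as a Lean object the stub is large
(Hilbert-space packaging of `H²_{σ,0}(T³)`, Leray projection, regularity). Sources: Galdi2011 (Ch. IX–X,
steady NS near a given state), Temam1979 (Ch. II §1), Magnus2022 Prop. 6.7 (in tree:
`Literature.Analysis.Calculus.exists_zero_near_of_simplifiedNewton`), doi:10.1137/0153002. -/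
theorem stub_newtonStep :
    ∀ (k : ℕ) (A C₀ : ℝ) (K₀ : ℕ), ∃ K : ℕ, ∀ C : ℝ, ∃ ν₀ : ℝ, 0 < ν₀ ∧
      ∀ (ν : ℝ) (f w : 𝕋³ → E³) (q : 𝕋³ → ℝ) (c : ℝ), 0 < ν → ν ≤ ν₀ →
        IsSmooth f → IsDivFree f → HasZeroMean f →
        IsSmooth w → IsSmooth q → IsDivFree w → HasZeroMean w → |c| ≤ C → (∀ x, ‖w x‖ ≤ C) →
        (∀ (i : Fin 3) x, ‖Torus.partialDeriv i w x‖ ≤ C * ν⁻¹) →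
        (∀ (i j : Fin 3) x, ‖Torus.partialDeriv i (Torus.partialDeriv j w) x‖ ≤ C * ν⁻¹ ^ 2) →
        MeasureTheory.integral MeasureTheory.volume (fun x =>
            ‖Torus.convect w w x - ν • Torus.laplacian w x + Torus.gradient q x -
              c • Torus.partialDeriv (2 : Fin 3) w x - f x‖ ^ 2) ≤ C * ν ^ K →
        (∀ (v : 𝕋³ → E³) (r : 𝕋³ → ℝ) (b : ℝ), IsSmooth v → IsSmooth r → IsDivFree v → HasZeroMean v →
          MeasureTheory.integral MeasureTheory.volume (fun x => ‖v x‖ ^ 2) + b ^ 2 ≤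
            (C₀ * ν⁻¹ ^ K₀) ^ 2 * (MeasureTheory.integral MeasureTheory.volume (fun x =>
              ‖Torus.convect w v x + Torus.convect v w x - ν • Torus.laplacian v x + Torus.gradient r x -
                c • Torus.partialDeriv (2 : Fin 3) v x - b • Torus.partialDeriv (2 : Fin 3) w x‖ ^ 2) +
              (MeasureTheory.integral MeasureTheory.volume (fun x =>
                inner ℝ (v x) (Torus.partialDeriv (2 : Fin 3) w x))) ^ 2)) →
        (∀ (g : 𝕋³ → E³) (s : ℝ), IsSmooth g → HasZeroMean g →
          ∃ (v : 𝕋³ → E³) (r : 𝕋³ → ℝ) (b : ℝ), IsSmooth v ∧ IsSmooth r ∧ IsDivFree v ∧ HasZeroMean v ∧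
            (∀ x, Torus.convect w v x + Torus.convect v w x - ν • Torus.laplacian v x + Torus.gradient r x -
                c • Torus.partialDeriv (2 : Fin 3) v x - b • Torus.partialDeriv (2 : Fin 3) w x = g x) ∧
            MeasureTheory.integral MeasureTheory.volume (fun x =>
                inner ℝ (v x) (Torus.partialDeriv (2 : Fin 3) w x)) = s ∧
            MeasureTheory.integral MeasureTheory.volume (fun x => ‖v x‖ ^ 2) + gradNormSq v +
                (∑ i : Fin 3, gradNormSq (Torus.partialDeriv i v)) + b ^ 2 ≤
              (A * (1 + |C₀| * ν⁻¹ ^ K₀) ^ k * (1 + |C|) ^ k * (1 + ν⁻¹) ^ k) ^ 2 *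
                (MeasureTheory.integral MeasureTheory.volume (fun x => ‖g x‖ ^ 2) + s ^ 2)) →
        ∃ (W : 𝕋³ → E³) (Q : 𝕋³ → ℝ) (c' : ℝ), IsSmooth W ∧ IsSmooth Q ∧ IsDivFree W ∧ HasZeroMean W ∧
          (∀ x, Torus.convect W W x - ν • Torus.laplacian W x + Torus.gradient Q x -
              c' • Torus.partialDeriv (2 : Fin 3) W x = f x) ∧
          |c' - c| ≤ 1 ∧
          MeasureTheory.integral MeasureTheory.volume (fun x => ‖W x‖ ^ 2) ≤
            2 * MeasureTheory.integral MeasureTheory.volume (fun x => ‖w x‖ ^ 2) + 1 ∧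
          |ν * gradNormSq W - ν * gradNormSq w| ≤ Real.sqrt ν := by
  sorry

/-- **stub 3 — DRIFT ABSORPTION: a drifting steady state is a classical steady Navier–Stokes solution of
the same force (Galilean bookkeeping on `T³`; size M).** If `W` (smooth, divergence free, mean zero),
`Q` (smooth) and `c'` satisfy `W·∇W − νΔW + ∇Q − c'∂₃W = f` pointwise, then `u := W − c'e₃`
(`e₃ = EuclideanSpace.single 2 1`) together with the pressure `Q`, both constant in time, is a classical
solution of `NS_ν(f)` on `T³ × ℝ` (`Torus.IsClassicalNSSolutionOn univ`), `‖∇u‖₂² = ‖∇W‖₂²`, and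
`∫‖u‖² = ∫‖W‖² + c'²`. Why true: `∂ₜu = 0` (`timeDerivWithin_const`); for `C¹` fields
`(u·∇)u = DW[W − c'e₃] = (W·∇)W − c'∂₃W` (`Torus.convect`, `partialDeriv_eq_fderiv_apply`, derivative of a
constant vanishes), so the momentum equation is the drifting steady equation rearranged; `div u = div W`;
joint smoothness of time-constant fields is `isSmoothSpaceTimeOn_const`; `∂ᵢ(W − c'e₃) = ∂ᵢW` gives
`gradNormSq`; `∫‖W − c'e₃‖² = ∫‖W‖² − 2c'⟪∫W, e₃⟫ + c'²` with `∫W = 0` and `volume T³ = 1`. Why it might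
fail: it should not — the only traps are the torus-calculus wrappers (`liftAt` of `x ↦ W x − const`) and
integrability side conditions (continuous on a compact torus). Sources: Galdi2011 (Galilean frames for
steady flows), folklore. Leans on: `Literature.Analysis.FluidPDE.isSmoothSpaceTimeOn_const`,
`timeDerivWithin_const`, `Torus.partialDeriv_eq_fderiv_apply`, `IsSmooth.integrable`,
`integral_inner`/`integral_sub/add`, `EuclideanSpace.norm_single`. -/
theorem stub_driftAbsorption :
    ∀ (ν : ℝ) (f W : 𝕋³ → E³) (Q : 𝕋³ → ℝ) (c' : ℝ), IsSmooth W → IsSmooth Q → IsDivFree W →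
      HasZeroMean W →
      (∀ x, Torus.convect W W x - ν • Torus.laplacian W x + Torus.gradient Q x -
          c' • Torus.partialDeriv (2 : Fin 3) W x = f x) →
      IsClassicalNSSolutionOn Set.univ ν (fun _ => f)
          (fun _ x => W x - c' • EuclideanSpace.single (2 : Fin 3) (1 : ℝ)) (fun _ => Q) ∧
        gradNormSq (fun x => W x - c' • EuclideanSpace.single (2 : Fin 3) (1 : ℝ)) = gradNormSq W ∧
        MeasureTheory.integral MeasureTheory.volume
            (fun x => ‖W x - c' • EuclideanSpace.single (2 : Fin 3) (1 : ℝ)‖ ^ 2) =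
          MeasureTheory.integral MeasureTheory.volume (fun x => ‖W x‖ ^ 2) + c' ^ 2 := by
  sorry

/-! ## Name-keyed aliases of the three stub statements — the hypotheses of `NewtonRealisation_of`

The native skeleton audit (`#h21_check_skeleton`, run by `ledger skeleton check`) admits a hypothesis of
the composing theorem only if its head constant is a registered obligation or is NAMED like a declared
stub; `__Registered.stub_X` is the statement of `stub_X` verbatim under the stub's short name (device of
`Cruxes/RecurrentDebris/Lines/birth.lean`, `Cruxes/CleanRoomInjectionFloor/Lines/birth.lean`). Each alias
is an `abbrev`, textually its stub's signature. -/
namespace __Registered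

/-- Alias of the statement of `stub_borderedSolvability` (bordered linear solvability, polynomial `H²` loss), keyed by the stub name. -/
abbrev stub_borderedSolvability : Prop :=
    ∃ (k : ℕ) (A : ℝ), ∀ (ν C C₀ : ℝ) (K₀ : ℕ) (w : 𝕋³ → E³) (c : ℝ), 0 < ν →
      IsSmooth w → IsDivFree w → HasZeroMean w → |c| ≤ C → (∀ x, ‖w x‖ ≤ C) →
      (∀ (i : Fin 3) x, ‖Torus.partialDeriv i w x‖ ≤ C * ν⁻¹) →
      (∀ (i j : Fin 3) x, ‖Torus.partialDeriv i (Torus.partialDeriv j w) x‖ ≤ C * ν⁻¹ ^ 2) →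
      (∀ (v : 𝕋³ → E³) (r : 𝕋³ → ℝ) (b : ℝ), IsSmooth v → IsSmooth r → IsDivFree v → HasZeroMean v →
        MeasureTheory.integral MeasureTheory.volume (fun x => ‖v x‖ ^ 2) + b ^ 2 ≤
          (C₀ * ν⁻¹ ^ K₀) ^ 2 * (MeasureTheory.integral MeasureTheory.volume (fun x =>
            ‖Torus.convect w v x + Torus.convect v w x - ν • Torus.laplacian v x + Torus.gradient r x -
              c • Torus.partialDeriv (2 : Fin 3) v x - b • Torus.partialDeriv (2 : Fin 3) w x‖ ^ 2) +
            (MeasureTheory.integral MeasureTheory.volume (fun x =>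
              inner ℝ (v x) (Torus.partialDeriv (2 : Fin 3) w x))) ^ 2)) →
      ∀ (g : 𝕋³ → E³) (s : ℝ), IsSmooth g → HasZeroMean g →
        ∃ (v : 𝕋³ → E³) (r : 𝕋³ → ℝ) (b : ℝ), IsSmooth v ∧ IsSmooth r ∧ IsDivFree v ∧ HasZeroMean v ∧
          (∀ x, Torus.convect w v x + Torus.convect v w x - ν • Torus.laplacian v x + Torus.gradient r x -
              c • Torus.partialDeriv (2 : Fin 3) v x - b • Torus.partialDeriv (2 : Fin 3) w x = g x) ∧
          MeasureTheory.integral MeasureTheory.volume (fun x =>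
              inner ℝ (v x) (Torus.partialDeriv (2 : Fin 3) w x)) = s ∧
          MeasureTheory.integral MeasureTheory.volume (fun x => ‖v x‖ ^ 2) + gradNormSq v +
              (∑ i : Fin 3, gradNormSq (Torus.partialDeriv i v)) + b ^ 2 ≤
            (A * (1 + |C₀| * ν⁻¹ ^ K₀) ^ k * (1 + |C|) ^ k * (1 + ν⁻¹) ^ k) ^ 2 *
              (MeasureTheory.integral MeasureTheory.volume (fun x => ‖g x‖ ^ 2) + s ^ 2)

/-- Alias of the statement of `stub_newtonStep` (Newton–Kantorovich step at fixed viscosity), keyed by the stub name. -/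
abbrev stub_newtonStep : Prop :=
    ∀ (k : ℕ) (A C₀ : ℝ) (K₀ : ℕ), ∃ K : ℕ, ∀ C : ℝ, ∃ ν₀ : ℝ, 0 < ν₀ ∧
      ∀ (ν : ℝ) (f w : 𝕋³ → E³) (q : 𝕋³ → ℝ) (c : ℝ), 0 < ν → ν ≤ ν₀ →
        IsSmooth f → IsDivFree f → HasZeroMean f →
        IsSmooth w → IsSmooth q → IsDivFree w → HasZeroMean w → |c| ≤ C → (∀ x, ‖w x‖ ≤ C) →
        (∀ (i : Fin 3) x, ‖Torus.partialDeriv i w x‖ ≤ C * ν⁻¹) →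
        (∀ (i j : Fin 3) x, ‖Torus.partialDeriv i (Torus.partialDeriv j w) x‖ ≤ C * ν⁻¹ ^ 2) →
        MeasureTheory.integral MeasureTheory.volume (fun x =>
            ‖Torus.convect w w x - ν • Torus.laplacian w x + Torus.gradient q x -
              c • Torus.partialDeriv (2 : Fin 3) w x - f x‖ ^ 2) ≤ C * ν ^ K →
        (∀ (v : 𝕋³ → E³) (r : 𝕋³ → ℝ) (b : ℝ), IsSmooth v → IsSmooth r → IsDivFree v → HasZeroMean v →
          MeasureTheory.integral MeasureTheory.volume (fun x => ‖v x‖ ^ 2) + b ^ 2 ≤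
            (C₀ * ν⁻¹ ^ K₀) ^ 2 * (MeasureTheory.integral MeasureTheory.volume (fun x =>
              ‖Torus.convect w v x + Torus.convect v w x - ν • Torus.laplacian v x + Torus.gradient r x -
                c • Torus.partialDeriv (2 : Fin 3) v x - b • Torus.partialDeriv (2 : Fin 3) w x‖ ^ 2) +
              (MeasureTheory.integral MeasureTheory.volume (fun x =>
                inner ℝ (v x) (Torus.partialDeriv (2 : Fin 3) w x))) ^ 2)) →
        (∀ (g : 𝕋³ → E³) (s : ℝ), IsSmooth g → HasZeroMean g →
          ∃ (v : 𝕋³ → E³) (r : 𝕋³ → ℝ) (b : ℝ), IsSmooth v ∧ IsSmooth r ∧ IsDivFree v ∧ HasZeroMean v ∧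
            (∀ x, Torus.convect w v x + Torus.convect v w x - ν • Torus.laplacian v x + Torus.gradient r x -
                c • Torus.partialDeriv (2 : Fin 3) v x - b • Torus.partialDeriv (2 : Fin 3) w x = g x) ∧
            MeasureTheory.integral MeasureTheory.volume (fun x =>
                inner ℝ (v x) (Torus.partialDeriv (2 : Fin 3) w x)) = s ∧
            MeasureTheory.integral MeasureTheory.volume (fun x => ‖v x‖ ^ 2) + gradNormSq v +
                (∑ i : Fin 3, gradNormSq (Torus.partialDeriv i v)) + b ^ 2 ≤
              (A * (1 + |C₀| * ν⁻¹ ^ K₀) ^ k * (1 + |C|) ^ k * (1 + ν⁻¹) ^ k) ^ 2 *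
                (MeasureTheory.integral MeasureTheory.volume (fun x => ‖g x‖ ^ 2) + s ^ 2)) →
        ∃ (W : 𝕋³ → E³) (Q : 𝕋³ → ℝ) (c' : ℝ), IsSmooth W ∧ IsSmooth Q ∧ IsDivFree W ∧ HasZeroMean W ∧
          (∀ x, Torus.convect W W x - ν • Torus.laplacian W x + Torus.gradient Q x -
              c' • Torus.partialDeriv (2 : Fin 3) W x = f x) ∧
          |c' - c| ≤ 1 ∧
          MeasureTheory.integral MeasureTheory.volume (fun x => ‖W x‖ ^ 2) ≤
            2 * MeasureTheory.integral MeasureTheory.volume (fun x => ‖w x‖ ^ 2) + 1 ∧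
          |ν * gradNormSq W - ν * gradNormSq w| ≤ Real.sqrt ν

/-- Alias of the statement of `stub_driftAbsorption` (drifting steady state ⇒ classical steady solution), keyed by the stub name. -/
abbrev stub_driftAbsorption : Prop :=
    ∀ (ν : ℝ) (f W : 𝕋³ → E³) (Q : 𝕋³ → ℝ) (c' : ℝ), IsSmooth W → IsSmooth Q → IsDivFree W →
      HasZeroMean W →
      (∀ x, Torus.convect W W x - ν • Torus.laplacian W x + Torus.gradient Q x -
          c' • Torus.partialDeriv (2 : Fin 3) W x = f x) →
      IsClassicalNSSolutionOn Set.univ ν (fun _ => f)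
          (fun _ x => W x - c' • EuclideanSpace.single (2 : Fin 3) (1 : ℝ)) (fun _ => Q) ∧
        gradNormSq (fun x => W x - c' • EuclideanSpace.single (2 : Fin 3) (1 : ℝ)) = gradNormSq W ∧
        MeasureTheory.integral MeasureTheory.volume
            (fun x => ‖W x - c' • EuclideanSpace.single (2 : Fin 3) (1 : ℝ)‖ ^ 2) =
          MeasureTheory.integral MeasureTheory.volume (fun x => ‖W x‖ ^ 2) + c' ^ 2

end __Registered

/-- **Composition** (kernel-checked, no `sorry` of its own): the three stub statements (as the
name-keyed aliases `__Registered.stub_*`) imply the crux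
`Summit.AnomalousDissipation.AnomalousDissipation.Theses.NeutralTaylorWaves.NewtonRealisation` BY NAME.
Selection along the nonresonant subsequence: `(k, A)` from stub 1, `K` from stub 2, `C = C_K` and the
certified quasi-steady states from `NonresonantTaylorWaves`, `ν₀` from stub 2, threshold
`δ = min ν₀ (ε₀ / (2(|C|+2)))²` reached beyond `N₁` (`ν_n → 0`), `n_j ≥ max N₁ j`; per `j`: stub 1 ⇒
solvability, stub 2 ⇒ exact drifting steady state, stub 3 ⇒ classical steady solution `u_j = W − c'e₃`;
energy `≤ 2E + 1 + (|C|+1)²`, dissipation `≥ ε₀/2`, `ν ∘ n → 0`. [bookkeeping] -/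
theorem NewtonRealisation_of :
    __Registered.stub_borderedSolvability → __Registered.stub_newtonStep →
      __Registered.stub_driftAbsorption →
        Summit.AnomalousDissipation.AnomalousDissipation.Theses.NeutralTaylorWaves.NewtonRealisation := by
  intro hL hN hD
  dsimp only [__Registered.stub_borderedSolvability, __Registered.stub_newtonStep,
    __Registered.stub_driftAbsorption] at hL hN hD
  unfold Summit.AnomalousDissipation.AnomalousDissipation.Theses.NeutralTaylorWaves.NewtonRealisation
  intro hX
  unfold Summit.AnomalousDissipation.AnomalousDissipation.Theses.NeutralTaylorWaves.NonresonantTaylorWaves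
    at hX
  obtain ⟨f, hf, hfd, hfm, ν, E, ε₀, C₀, K₀, hνpos, hνlim, hε₀, hX⟩ := hX
  -- universal constants of the linear theory, then the order `K` of the Newton step
  obtain ⟨k, A, hL⟩ := hL
  obtain ⟨K, hN⟩ := hN k A C₀ K₀
  obtain ⟨C, hX⟩ := hX K
  obtain ⟨ν₀, hν₀, hN⟩ := hN C
  -- viscosity threshold: Newton step (`ν ≤ ν₀`) and dissipation bookkeeping (`(|C|+2)√ν ≤ ε₀/2`)
  have hC2 : 0 < |C| + 2 := by positivity
  set δ : ℝ := min ν₀ ((ε₀ / (2 * (|C| + 2))) ^ 2) with hδ_def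
  have hδpos : 0 < δ := lt_min hν₀ (by positivity)
  obtain ⟨N₁, hN₁⟩ : ∃ N₁ : ℕ, ∀ m, N₁ ≤ m → ν m < δ :=
    Filter.eventually_atTop.1 ((tendsto_order.1 hνlim).2 δ hδpos)
  -- the nonresonant subsequence beyond the threshold, with its certified quasi-steady states
  choose n hn w q c hw hq hwd hwm hcC hwE hdiss hres hsup₀ hsup₁ hsup₂ hap using
    fun j : ℕ => hX (max N₁ j)
  have hjn : ∀ j, j ≤ n j := fun j => le_trans (le_max_right _ _) (hn j)
  have hnδ : ∀ j, ν (n j) < δ := fun j => hN₁ _ (le_trans (le_max_left _ _) (hn j))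
  -- realisation at each `j`: linear solvability ⇒ Newton step ⇒ drift absorption
  have hreal : ∀ j : ℕ, ∃ (u : 𝕋³ → E³) (p : 𝕋³ → ℝ),
      IsClassicalNSSolutionOn Set.univ (ν (n j)) (fun _ => f) (fun _ => u) (fun _ => p) ∧
        MeasureTheory.integral MeasureTheory.volume (fun x => ‖u x‖ ^ 2) ≤ 2 * E + 1 + (|C| + 1) ^ 2 ∧
        ε₀ / 2 ≤ ν (n j) * gradNormSq u := by
    intro j
    have hνj : 0 < ν (n j) := hνpos _
    have hνδ : ν (n j) < δ := hnδ j
    have hν₀' : ν (n j) ≤ ν₀ := le_trans hνδ.le (min_le_left _ _)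
    -- stub 1: bordered solvability with polynomial `H²` loss, from the a-priori bound
    have hsolv := hL (ν (n j)) C C₀ K₀ (w j) (c j) hνj (hw j) (hwd j) (hwm j) (hcC j) (hsup₀ j)
      (hsup₁ j) (hsup₂ j) (hap j)
    -- stub 2: the Newton–Kantorovich step
    obtain ⟨W, Q, c', hW, hQ, hWd, hWm, hWeq, hcc', hWE, hWdiss⟩ :=
      hN (ν (n j)) f (w j) (q j) (c j) hνj hν₀' hf hfd hfm (hw j) (hq j) (hwd j) (hwm j) (hcC j)
        (hsup₀ j) (hsup₁ j) (hsup₂ j) (hres j) (hap j) hsolv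
    -- stub 3: drift absorption
    obtain ⟨hsol, hgrad, hen⟩ := hD (ν (n j)) f W Q c' hW hQ hWd hWm hWeq
    refine ⟨fun x => W x - c' • EuclideanSpace.single (2 : Fin 3) (1 : ℝ), Q, hsol, ?_, ?_⟩
    · -- energy: `∫‖u‖² = ∫‖W‖² + c'² ≤ 2∫‖w‖² + 1 + (|C|+1)²`
      have h1 : |c'| ≤ |C| + 1 := by
        have h1a := abs_sub_abs_le_abs_sub c' (c j)
        have h1b : |c j| ≤ |C| := le_trans (hcC j) (le_abs_self C)
        linarith
      have h3 : c' ^ 2 ≤ (|C| + 1) ^ 2 := by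
        refine sq_le_sq.2 ?_
        rw [abs_of_nonneg (by positivity : (0 : ℝ) ≤ |C| + 1)]
        exact h1
      have hwEj := hwE j
      rw [hen]
      linarith
    · -- dissipation: `ν‖∇u‖² = ν‖∇W‖² ≥ ν‖∇w‖² − √ν ≥ ε₀ − C√ν − √ν ≥ ε₀/2`
      rw [hgrad]
      have hsq0 : 0 ≤ Real.sqrt (ν (n j)) := Real.sqrt_nonneg _
      have hs : Real.sqrt (ν (n j)) < ε₀ / (2 * (|C| + 2)) := by
        have hlt : ν (n j) < (ε₀ / (2 * (|C| + 2))) ^ 2 := lt_of_lt_of_le hνδ (min_le_right _ _)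
        calc Real.sqrt (ν (n j)) < Real.sqrt ((ε₀ / (2 * (|C| + 2))) ^ 2) :=
              Real.sqrt_lt_sqrt hνj.le hlt
          _ = ε₀ / (2 * (|C| + 2)) := Real.sqrt_sq (by positivity)
      have h4 : (|C| + 2) * Real.sqrt (ν (n j)) < ε₀ / 2 := by
        calc (|C| + 2) * Real.sqrt (ν (n j)) < (|C| + 2) * (ε₀ / (2 * (|C| + 2))) := by gcongr
          _ = ε₀ / 2 := by field_simp
      rw [add_mul] at h4
      have h5 : C * Real.sqrt (ν (n j)) ≤ |C| * Real.sqrt (ν (n j)) :=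
        mul_le_mul_of_nonneg_right (le_abs_self C) hsq0
      have hd1 := abs_le.1 (hdiss j)
      have hd2 := abs_le.1 hWdiss
      linarith [hd1.1, hd1.2, hd2.1, hd2.2]
  choose u p hsol hEn hDis using hreal
  refine ⟨f, hf, hfd, hfm, fun j => ν (n j), u, p, fun j => hνpos (n j), ?_, hsol,
    ⟨2 * E + 1 + (|C| + 1) ^ 2, hEn⟩, ε₀ / 2, half_pos hε₀, hDis⟩
  exact hνlim.comp (tendsto_atTop_mono hjn tendsto_id)

/-- WIRING CHECK: the three sorried stubs compose to a closed term of the crux's type (modulo their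
`sorry`s). Deliberately an `example` (no constant enters the environment). -/
example : Summit.AnomalousDissipation.AnomalousDissipation.Theses.NeutralTaylorWaves.NewtonRealisation :=
  NewtonRealisation_of stub_borderedSolvability stub_newtonStep stub_driftAbsorption

end Summit.AnomalousDissipation.AnomalousDissipation.Cruxes.NewtonRealisation.Birth

end
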